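import Summits.RiemannHypothesis.RiemannHypothesis.Theorems.TiltedLandingLaw421MonovariantTentInit

/-! # TiltedLandingLaw421MonovariantDiscInit
c13 DISCOUNTED tent meter (C6 seal l.5163, C4 §V tokens): `tentCountR`, `discTentMeterMax`, `discReading_le_purse`, anchor-free INIT `monovariantInit_discTentMeterMax` (0 ≤ ρ, ρ² ≤ 3) and `…_three_halves`.
SUPPORT module for crux `TiltedLandingLaw421` (stmt-RiemannHypothesis-24774), `--supports` only: proves no stub, no crux; fully proved (no `sorry`).
Packaged by C4 rh-idea-6 g21 per director (CA239)(1) in the (CA237) lint shape. RH is not proved. -/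

namespace RhIdea6.G21.W07C13.DiscTent

open Complex
open RhIdea6.G17.W07C7 RhIdea6.G17.W07C7.Rev6 RhIdea6.G18.W07C8.Law421BirthS RhIdea6.G19.W07C11.Seam
open RhIdea6.G20.W07C12.Frac RhIdea6.G20.W07C12.StColP RhW07.C12.FieldSplit RhIdea6.G20.W07C13pre.Tent RhIdea6.G21.W07C13.TentMax

/-- C6 ADD-19 (1) verbatim: §T's `tentCount` ∩ the x₀-column of half-width `R`, ℕ-valued. -/
noncomputable def tentCountR (g : ℂ → ℂ) (x₀ R c r : ℝ) (u : ℂ) : ℕ :=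
  ∑ᶠ z ∈ {z : ℂ | g z = 0 ∧ |z.re - c| ≤ r ∧ |z.re - x₀| ≤ R ∧ z ≠ u ∧ z ≠ (starRingEnd ℂ) u}, (analyticOrderAt g z).toNat

/-- C6 SEAL l.5163 verbatim: the OFF-COLUMN-DISCOUNTED, FLOORED lineage tent, TIE = MAX (`sSup` over `{0} ∪ readings`). -/
noncomputable def discTentMeterMax (ρ : ℝ) : LevelMeter := fun η f x₀ s hmax R Hs B j =>
  sSup ({0} ∪ {m : ℝ | ∃ u : ℂ, IsLowest StCol' η f x₀ s hmax R Hs B j u ∧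
    m = (tentCountR (iteratedDeriv j f) x₀ R u.re (ρ * u.im) u : ℝ) - 2 * |u.re - x₀| / s})

/-- (K) PAIR BOOKKEEPING for the truncated count (clone of §U `tentCount_add_two_le_stripCount` with the column conjunct available to the containment). -/
theorem tentCountR_add_two_le_stripCount {f : ℂ → ℂ} (hd : Differentiable ℂ f) (hne : f ≠ 0)
    (hreal : ∀ x : ℝ, (f (x : ℂ)).im = 0) {Hs : ℝ} (hband : ∀ w : ℂ, f w = 0 → |w.im| ≤ Hs)
    {u : ℂ} (hu0 : f u = 0) (huim : 0 < u.im) {x₀ R c r t : ℝ}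
    (ht : ∀ z : ℂ, |z.re - u.re| ≤ t → |z.re - x₀| ≤ R → |z.re - c| ≤ r) (huc : |u.re - c| ≤ r) :
    (tentCountR f x₀ R u.re t u : ℝ) + 2 ≤ stripCount f c r := by
  classical
  have hSfin : {z : ℂ | f z = 0 ∧ |z.re - c| ≤ r}.Finite := strip_zeros_finite hd hne hband c r
  have hTS : {z : ℂ | f z = 0 ∧ |z.re - u.re| ≤ t ∧ |z.re - x₀| ≤ R ∧ z ≠ u ∧ z ≠ (starRingEnd ℂ) u}
      ⊆ {z : ℂ | f z = 0 ∧ |z.re - c| ≤ r} :=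
    fun z hz => ⟨hz.1, ht z hz.2.1 hz.2.2.1⟩
  have hTfin : {z : ℂ | f z = 0 ∧ |z.re - u.re| ≤ t ∧ |z.re - x₀| ≤ R ∧ z ≠ u ∧ z ≠ (starRingEnd ℂ) u}.Finite :=
    hSfin.subset hTS
  have eS : stripCount f c r = ∑ z ∈ hSfin.toFinset, ((analyticOrderAt f z).toNat : ℝ) := by
    unfold stripCount
    exact finsum_mem_eq_finite_toFinset_sum _ hSfin
  have eT : tentCountR f x₀ R u.re t u = ∑ z ∈ hTfin.toFinset, (analyticOrderAt f z).toNat := by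
    unfold tentCountR
    exact finsum_mem_eq_finite_toFinset_sum _ hTfin
  have hub0 : f ((starRingEnd ℂ) u) = 0 := conj_zero_of_real_entire hd hreal hu0
  have hne_pair : u ≠ (starRingEnd ℂ) u := by
    intro h
    have him := congrArg Complex.im h
    rw [Complex.conj_im] at him
    linarith
  have huS : u ∈ hSfin.toFinset := by
    rw [Set.Finite.mem_toFinset]; exact ⟨hu0, huc⟩
  have hubS : (starRingEnd ℂ) u ∈ hSfin.toFinset := by
    rw [Set.Finite.mem_toFinset]
    refine ⟨hub0, ?_⟩
    rw [Complex.conj_re]; exact huc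
  have huT : u ∉ hTfin.toFinset := by
    rw [Set.Finite.mem_toFinset]; exact fun h => h.2.2.2.1 rfl
  have hubT : (starRingEnd ℂ) u ∉ hTfin.toFinset := by
    rw [Set.Finite.mem_toFinset]; exact fun h => h.2.2.2.2 rfl
  have huT' : u ∉ insert ((starRingEnd ℂ) u) hTfin.toFinset := by
    rw [Finset.mem_insert, not_or]; exact ⟨hne_pair, huT⟩
  have hsub : insert u (insert ((starRingEnd ℂ) u) hTfin.toFinset) ⊆ hSfin.toFinset := by
    intro z hz
    rcases Finset.mem_insert.mp hz with rfl | hz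
    · exact huS
    rcases Finset.mem_insert.mp hz with rfl | hz
    · exact hubS
    · rw [Set.Finite.mem_toFinset] at hz ⊢; exact hTS hz
  have hle := Finset.sum_le_sum_of_subset_of_nonneg hsub
    (fun z _ _ => (Nat.cast_nonneg _ : (0 : ℝ) ≤ ((analyticOrderAt f z).toNat : ℝ)))
  rw [Finset.sum_insert huT', Finset.sum_insert hubT] at hle
  have hwu : (1 : ℝ) ≤ ((analyticOrderAt f u).toNat : ℝ) := one_le_orderToNat_of_zero hd hne hu0
  have hwub : (1 : ℝ) ≤ ((analyticOrderAt f ((starRingEnd ℂ) u)).toNat : ℝ) := one_le_orderToNat_of_zero hd hne hub0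
  have ecast : (tentCountR f x₀ R u.re t u : ℝ) = ∑ z ∈ hTfin.toFinset, ((analyticOrderAt f z).toNat : ℝ) := by
    rw [eT, Nat.cast_sum]
  rw [eS, ecast]
  linarith

/-- ★★ (K) **C6's INIT clause, per state, NO anchor**: the discounted level-0 reading of ANY `StCol'` state is `≤ (Hs/s)² + B + 1` for `0 ≤ ρ`, `ρ² ≤ 3`. -/
theorem discReading_le_purse {η : ℝ} {f : ℂ → ℂ} {x₀ s hmax R Hs : ℝ} {B : ℕ} (hE : EngineHyps5 2 η f x₀ s hmax R Hs B)
    {u : ℂ} (hu : StCol' η f x₀ s hmax R Hs B 0 u) {ρ : ℝ} (hρ0 : 0 ≤ ρ) (hρ : ρ ^ 2 ≤ 3) :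
    (tentCountR (iteratedDeriv 0 f) x₀ R u.re (ρ * u.im) u : ℝ) - 2 * |u.re - x₀| / s ≤ (Hs / s) ^ 2 + B + 1 := by
  obtain ⟨hdiff, hreal, -, hs, hCs, hChm, h3hm, -, hband, hCHs, -, hCB, -⟩ := hE
  obtain ⟨hf0, hu0, huim, hure, huHs⟩ := hu
  simp only [iteratedDeriv_zero] at hf0 hu0 ⊢
  have hure' : |u.re - x₀| ≤ R / 2 := by simpa using hure
  have hd0 : 0 ≤ |u.re - x₀| := abs_nonneg _
  have hρh : 0 ≤ ρ * u.im := mul_nonneg hρ0 huim.le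
  have hsR : s ≤ R := by nlinarith
  -- the budget radius (C6): r := max s (min R (|δ| + ρ·Im u))
  set r : ℝ := max s (min R (|u.re - x₀| + ρ * u.im)) with hr
  have hsr : s ≤ r := le_max_left _ _
  have hrR : r ≤ R := max_le hsR (min_le_left _ _)
  have hT : (tentCountR f x₀ R u.re (ρ * u.im) u : ℝ) + 2 ≤ stripCount f x₀ r := by
    refine tentCountR_add_two_le_stripCount hdiff hf0 hreal hband hu0 huim ?_ ?_
    · intro z hz hzR
      have h1 := abs_sub_le z.re u.re x₀
      have h2 : |z.re - x₀| ≤ min R (|u.re - x₀| + ρ * u.im) := le_min hzR (by linarith)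
      exact h2.trans (le_max_right _ _)
    · have h2 : |u.re - x₀| ≤ min R (|u.re - x₀| + ρ * u.im) := le_min (by linarith) (by linarith)
      exact h2.trans (le_max_right _ _)
  have hbud : stripCount f x₀ r - 2 * r / s ≤ B := hCB r hsr hrR
  have hh : (u.im / s) ^ 2 ≤ (Hs / s) ^ 2 := by
    have h1 : 0 ≤ u.im / s := div_nonneg huim.le hs.le
    have h2 : u.im / s ≤ Hs / s := div_le_div_of_nonneg_right huHs hs.le
    nlinarith
  rcases le_or_gt s (|u.re - x₀| + ρ * u.im) with hcase | hcase
  · -- CASE |δ| + ρh ≥ s: r ≤ |δ| + ρh, discount pays the displacement, razor pays the slope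
    have hr_le : r ≤ |u.re - x₀| + ρ * u.im := max_le hcase (min_le_right _ _)
    have h2r : 2 * r / s ≤ (2 * |u.re - x₀| + 2 * ρ * u.im) / s := div_le_div_of_nonneg_right (by linarith) hs.le
    have e : (2 * |u.re - x₀| + 2 * ρ * u.im) / s = 2 * |u.re - x₀| / s + 2 * ρ * (u.im / s) := by
      ring
    have hz := razor (h := u.im / s) hρ
    rw [e] at h2r
    linarith
  · -- CASE |δ| + ρh < s: r = s, T ≤ B
    have hmin : min R (|u.re - x₀| + ρ * u.im) ≤ s := (min_le_right _ _).trans hcase.le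
    have hr_eq : r = s := by rw [hr]; exact max_eq_left hmin
    have h2s : 2 * s / s = 2 := by rw [mul_div_assoc, div_self hs.ne', mul_one]
    rw [hr_eq] at hT
    rw [hr_eq, h2s] at hbud
    have hdisc : 0 ≤ 2 * |u.re - x₀| / s := div_nonneg (by linarith) hs.le
    have hp : (0 : ℝ) ≤ (Hs / s) ^ 2 := sq_nonneg _
    linarith

/-- (K) the reading set of a level in IMAGE form (for finiteness). -/
theorem discReadings_eq_image (ρ η : ℝ) (f : ℂ → ℂ) (x₀ s hmax R Hs : ℝ) (B j : ℕ) :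
    {m : ℝ | ∃ u : ℂ, IsLowest StCol' η f x₀ s hmax R Hs B j u ∧
      m = (tentCountR (iteratedDeriv j f) x₀ R u.re (ρ * u.im) u : ℝ) - 2 * |u.re - x₀| / s}
    = (fun u : ℂ => (tentCountR (iteratedDeriv j f) x₀ R u.re (ρ * u.im) u : ℝ) - 2 * |u.re - x₀| / s) ''
        {u : ℂ | IsLowest StCol' η f x₀ s hmax R Hs B j u} := by
  ext m
  simp only [Set.mem_setOf_eq, Set.mem_image]
  constructor
  · rintro ⟨u, hu, rfl⟩; exact ⟨u, hu, rfl⟩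
  · rintro ⟨u, hu, rfl⟩; exact ⟨u, hu, rfl⟩

/-- (K) under the engine hypotheses the floored meter is `≥ 0` (the `{0}` is in a finite, hence bounded, set). -/
theorem discTentMeterMax_nonneg {η : ℝ} {f : ℂ → ℂ} {x₀ s hmax R Hs : ℝ} {B : ℕ} (hE : EngineHyps5 2 η f x₀ s hmax R Hs B) (ρ : ℝ) (j : ℕ) :
    0 ≤ discTentMeterMax ρ η f x₀ s hmax R Hs B j := by
  have hfin : ({0} ∪ {m : ℝ | ∃ u : ℂ, IsLowest StCol' η f x₀ s hmax R Hs B j u ∧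
      m = (tentCountR (iteratedDeriv j f) x₀ R u.re (ρ * u.im) u : ℝ) - 2 * |u.re - x₀| / s}).Finite := by
    refine Set.Finite.union (Set.finite_singleton 0) ?_
    rw [discReadings_eq_image]
    exact (isLowest_finite hE j).image _
  exact le_csSup hfin.bddAbove (Set.mem_union_left _ (Set.mem_singleton 0))

/-- ★★★ (K) **C6's (β2′) INIT, anchor-free**: `0 ≤ ρ → ρ² ≤ 3 → MonovariantInit (discTentMeterMax ρ)`. -/
theorem monovariantInit_discTentMeterMax {ρ : ℝ} (hρ0 : 0 ≤ ρ) (hρ : ρ ^ 2 ≤ 3) : MonovariantInit (discTentMeterMax ρ) := by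
  intro η f x₀ s hmax R Hs B hE
  show sSup ({0} ∪ {m : ℝ | ∃ u : ℂ, IsLowest StCol' η f x₀ s hmax R Hs B 0 u ∧
      m = (tentCountR (iteratedDeriv 0 f) x₀ R u.re (ρ * u.im) u : ℝ) - 2 * |u.re - x₀| / s}) ≤ (Hs / s) ^ 2 + B + 1
  apply csSup_le ⟨0, Set.mem_union_left _ (Set.mem_singleton 0)⟩
  intro m hm
  rcases hm with hm | ⟨u, hu, rfl⟩
  · rw [Set.mem_singleton_iff] at hm
    rw [hm]; positivity
  · exact discReading_le_purse hE hu.1 hρ0 hρ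

/-- ★ (K) at C6's sealed slope. -/
theorem monovariantInit_discTentMeterMax_three_halves : MonovariantInit (discTentMeterMax (3 / 2)) :=
  monovariantInit_discTentMeterMax (by norm_num) (by norm_num)

end RhIdea6.G21.W07C13.DiscTent
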